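import Literature.NumberTheory.GaloisRepresentations.DualNumberLifts
import HarnessLib

/-!
# Deformation conditions at the dual numbers, in terms of cocycles
# (Mazur §21–§23; Böckle Thm. 2.2 (a), Lemma 7.2/7.4)

Topic `Literature/NumberTheory/GaloisRepresentations`.  Continuation of `DualNumberLifts.lean`
(lifts `ρ = (1 + εc)ρ̄ : Γ → GL_n(K[ε])` of `ρ̄` ↔ `ad ρ̄`-cocycles `c`).  The conditions cutting
out a deformation functor translate into conditions on the cocycle — the dictionary by which
"the tangent space of a deformation problem with local conditions is a Selmer group"
([Maz97, §21 `t ≅ H¹(Π, ad ρ̄)`, §23 deformation conditions]; Böckle [Böc07, Thm. 2.2 (a),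
Ex. 7.1, Lemma 7.2 and 7.4: the tangent space of the `P`-nearly ordinary functor]).  Everything
is PROVED, for an arbitrary group `Γ`:

* `DualLift.apply_eq_one_iff` — `ρ(g) = 1 ⟺ ρ̄(g) = 1 ∧ c(g) = 0`; hence
  `DualLift.forall_apply_eq_one_iff`: `ρ` is trivial on a subset `H` (e.g. an inertia group:
  "unramified") iff `ρ̄` is and `c` vanishes on `H`.
* `DualLift.isOpen_ker_iff_continuous` — for a topological group `Γ` and `ρ̄` with open kernel:
  `ker ρ` is open iff the cocycle `c : Γ → M_n(K)` is continuous for the discrete topology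
  (continuity of lifts to `K[ε]` ⟺ continuity of cocycles).
* `DualLift.exists_noFrame_iff` — the **nearly ordinary condition** (`n = 2`): given a frame
  `f ∈ GL₂(K)` with `f⁻¹ ρ̄(δ) f` upper triangular along `ι : Δ → Γ` (a decomposition group),
  there is `P ∈ GL₂(K[ε])` with `f⁻¹ P̄` upper triangular and `P⁻¹ ρ(ι δ) P` upper triangular for
  all `δ` iff for some `Y ∈ M₂(K)` all `f⁻¹ c(ι δ) f + ρ̄_f(δ) Y ρ̄_f(δ)⁻¹ − Y` (`ρ̄_f = f⁻¹ρ̄f`)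
  are upper triangular — i.e. the class of `c|_Δ` comes from `H¹(Δ, 𝔟)`, `𝔟` the Borel of the
  special line `f e₁` (the tangent condition of Tilouine's/Böckle's `P`-nearly ordinary
  deformations, [Böc07, Ex. 7.1 and Lemma 7.4]).

## References

* B. Mazur, *An introduction to the deformation theory of Galois representations* (1997), §21,
  §23. [cite: Mazur1997Deformation, §21]
* G. Böckle, *Presentations of universal deformation rings*, LMS LNS 320 (2007), Thm. 2.2 (a),
  Ex. 7.1, Lemma 7.2, Lemma 7.4. [cite: Bockle2007Presentations, Lemma 7.4]
-/

noncomputable section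

namespace Literature.NumberTheory.GaloisRepresentations.Deformation

open Matrix TrivSqZeroExt

variable {Γ : Type*} [Group Γ] {K : Type*} [CommRing K] {n : Type*} [Fintype n] [DecidableEq n]
  {ρbar : Γ →* GL n K}

namespace DualLift

/-! ## Triviality: `ρ(g) = 1 ⟺ ρ̄(g) = 1 ∧ c(g) = 0` -/

/-- The `ε`-part of a lift is its cocycle times `ρ̄`: `snd ρ(g) = c(g) ρ̄(g)`. [folklore] -/
theorem sndPart_eq_cocycle_mul (ρ : DualLift ρbar) (g : Γ) :
    ρ.sndPart g = (ρ.cocycle).1 g * (ρbar g).val := by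
  rw [cocycle_apply, Matrix.mul_assoc, ← Units.val_mul, inv_mul_cancel, Units.val_one,
    Matrix.mul_one]
  rfl

/-- **`ρ(g) = 1 ⟺ ρ̄(g) = 1` and `c(g) = 0`.** [cite: Mazur1997Deformation, §21] -/
theorem apply_eq_one_iff (ρ : DualLift ρbar) (g : Γ) :
    ρ.1 g = 1 ↔ ρbar g = 1 ∧ (ρ.cocycle).1 g = 0 := by
  constructor
  · intro h
    have hbar : ρbar g = 1 := by
      apply Units.ext
      rw [← ρ.2 g, h, Units.val_one, Units.val_one, matrix_map_fst_one]
    refine ⟨hbar, ?_⟩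
    rw [cocycle_apply, h, Units.val_one, matrix_map_snd_one, Matrix.zero_mul]
  · rintro ⟨hbar, hc⟩
    apply Units.ext
    refine matrix_ext_fst_snd ?_ ?_
    · rw [ρ.2 g, hbar, Units.val_one, Units.val_one, matrix_map_fst_one]
    · change ρ.sndPart g = _
      rw [sndPart_eq_cocycle_mul, hc, Matrix.zero_mul, Units.val_one, matrix_map_snd_one]

/-- **A lift is trivial on `H` iff `ρ̄` is trivial on `H` and the cocycle vanishes on `H`** — e.g.
`H` an inertia group: `ρ` is unramified iff `ρ̄` is and `c|_H = 0`. [cite: Mazur1997Deformation, §21] -/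
theorem forall_apply_eq_one_iff (ρ : DualLift ρbar) (H : Set Γ) :
    (∀ g ∈ H, ρ.1 g = 1) ↔ (∀ g ∈ H, ρbar g = 1) ∧ ∀ g ∈ H, (ρ.cocycle).1 g = 0 := by
  simp only [apply_eq_one_iff]
  exact ⟨fun h => ⟨fun g hg => (h g hg).1, fun g hg => (h g hg).2⟩,
    fun h g hg => ⟨h.1 g hg, h.2 g hg⟩⟩

/-- The cocycle of a lift is right-invariant under `ker ρ`: `c(gh) = c(g)` for `ρ(h) = 1`.
[folklore] -/
theorem cocycle_mul_of_apply_eq_one (ρ : DualLift ρbar) (g : Γ) {h : Γ} (hh : ρ.1 h = 1) :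
    (ρ.cocycle).1 (g * h) = (ρ.cocycle).1 g := by
  obtain ⟨hbar, hc⟩ := (apply_eq_one_iff ρ h).mp hh
  rw [(ρ.cocycle).2 g h, hc, Matrix.mul_zero, Matrix.zero_mul, add_zero]

/-! ## Continuity: `ker ρ` open ⟺ `c` continuous -/

section Topology

variable [TopologicalSpace Γ] [ContinuousMul Γ] [TopologicalSpace (Matrix n n K)]
  [DiscreteTopology (Matrix n n K)]

omit [DiscreteTopology (Matrix n n K)] in
/-- A function on a topological group which is right-invariant under an open subgroup is
continuous (for any topology on the target). [folklore] -/
theorem continuous_of_mul_mem_eq {X : Type*} [TopologicalSpace X] (U : Subgroup Γ)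
    (hU : IsOpen (U : Set Γ)) (f : Γ → X) (hf : ∀ g, ∀ h ∈ U, f (g * h) = f g) : Continuous f := by
  refine continuous_def.2 fun T _ => ?_
  rw [isOpen_iff_forall_mem_open]
  intro γ hγ
  refine ⟨{x | γ⁻¹ * x ∈ U}, fun x hx => ?_, hU.preimage (continuous_const.mul continuous_id), ?_⟩
  · simp only [Set.mem_setOf_eq] at hx
    show f x ∈ T
    have : f x = f γ := by
      have h := hf γ (γ⁻¹ * x) hx
      rwa [mul_inv_cancel_left] at h
    rw [this]
    exact hγ
  · simp

/-- **Continuity of lifts to `K[ε]` ⟺ continuity of cocycles**: if `ρ̄` has open kernel, the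
lift `ρ = (1 + εc)ρ̄` has open kernel iff `c : Γ → M_n(K)` is continuous (`M_n(K)` discrete),
since `ker ρ = ker ρ̄ ∩ c⁻¹(0)` and `c` is constant on cosets of `ker ρ`.
[cite: Mazur1997Deformation, §21] -/
theorem isOpen_ker_iff_continuous (ρ : DualLift ρbar) (hbar : IsOpen (ρbar.ker : Set Γ)) :
    IsOpen ((ρ.1).ker : Set Γ) ↔ Continuous (ρ.cocycle).1 := by
  constructor
  · intro hopen
    exact continuous_of_mul_mem_eq (ρ.1).ker hopen _ fun g h hh =>
      cocycle_mul_of_apply_eq_one ρ g hh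
  · intro hc
    have hker : ((ρ.1).ker : Set Γ) = (ρbar.ker : Set Γ) ∩ (ρ.cocycle).1 ⁻¹' {0} := by
      ext g
      simp only [SetLike.mem_coe, MonoidHom.mem_ker, Set.mem_inter_iff, Set.mem_preimage,
        Set.mem_singleton_iff]
      exact apply_eq_one_iff ρ g
    rw [hker]
    exact hbar.inter (hc.isOpen_preimage _ (isOpen_discrete _))

end Topology

/-! ## The nearly ordinary condition (`n = 2`) -/

section NearlyOrdinary

variable {K : Type*} [CommRing K] {ρbar : Γ →* GL (Fin 2) K}

/-- Right multiplication by an invertible upper-triangular `2 × 2` matrix does not change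
whether the lower-left entry vanishes. [folklore] -/
theorem mul_lowerLeft_eq_zero_iff_of_upper {Q : GL (Fin 2) K} (hQ : Q.val 1 0 = 0)
    (X : Matrix (Fin 2) (Fin 2) K) : (X * Q.val) 1 0 = 0 ↔ X 1 0 = 0 := by
  have hdetQ : IsUnit Q.val.det := Matrix.isUnits_det_units Q
  rw [det_fin_two, hQ, mul_zero, sub_zero] at hdetQ
  have hQ00 : IsUnit (Q.val 0 0) := isUnit_of_mul_isUnit_left hdetQ
  have hentry : (X * Q.val) 1 0 = X 1 0 * Q.val 0 0 := by
    simp only [Matrix.mul_apply, Fin.sum_univ_two, hQ, mul_zero, add_zero]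
  rw [hentry]
  exact hQ00.mul_left_eq_zero

/-- `fst (P⁻¹) = (fst P)⁻¹`. [folklore] -/
theorem map_fst_inv (P : GL (Fin 2) (TrivSqZeroExt K K)) (Pbar : GL (Fin 2) K)
    (hP : P.val.map fst = Pbar.val) : P⁻¹.val.map fst = Pbar⁻¹.val := by
  have h := congrArg (fun M : Matrix (Fin 2) (Fin 2) (TrivSqZeroExt K K) => M.map fst) P.inv_mul
  simp only [matrix_map_fst_mul, hP, matrix_map_fst_one] at h
  calc P⁻¹.val.map fst = P⁻¹.val.map fst * Pbar.val * Pbar⁻¹.val := by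
        rw [Matrix.mul_assoc, ← Units.val_mul, mul_inv_cancel, Units.val_one, Matrix.mul_one]
    _ = Pbar⁻¹.val := by rw [h, Matrix.one_mul]

/-- `snd (P⁻¹) = −P̄⁻¹ (snd P) P̄⁻¹`. [folklore] -/
theorem map_snd_inv (P : GL (Fin 2) (TrivSqZeroExt K K)) (Pbar : GL (Fin 2) K)
    (hP : P.val.map fst = Pbar.val) :
    P⁻¹.val.map snd = -(Pbar⁻¹.val * P.val.map snd * Pbar⁻¹.val) := by
  have h := congrArg (fun M : Matrix (Fin 2) (Fin 2) (TrivSqZeroExt K K) => M.map snd) P.inv_mul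
  simp only [matrix_map_snd_mul, hP, map_fst_inv P Pbar hP, matrix_map_snd_one] at h
  -- `h : P̄⁻¹ snd P + snd(P⁻¹) P̄ = 0`
  have h2 : P⁻¹.val.map snd * Pbar.val = -(Pbar⁻¹.val * P.val.map snd) :=
    eq_neg_of_add_eq_zero_right h
  calc P⁻¹.val.map snd = P⁻¹.val.map snd * Pbar.val * Pbar⁻¹.val := by
        rw [Matrix.mul_assoc, ← Units.val_mul, mul_inv_cancel, Units.val_one, Matrix.mul_one]
    _ = -(Pbar⁻¹.val * P.val.map snd * Pbar⁻¹.val) := by rw [h2, Matrix.neg_mul]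

/-- `fst (P⁻¹ ρ(g) P) = P̄⁻¹ ρ̄(g) P̄`. [folklore] -/
theorem map_fst_conj (ρ : DualLift ρbar) (P : GL (Fin 2) (TrivSqZeroExt K K)) (g : Γ)
    (Pbar : GL (Fin 2) K) (hP : P.val.map fst = Pbar.val) :
    (P⁻¹ * ρ.1 g * P).val.map fst = Pbar⁻¹.val * (ρbar g).val * Pbar.val := by
  rw [Units.val_mul, Units.val_mul, matrix_map_fst_mul, matrix_map_fst_mul, map_fst_inv P Pbar hP,
    ρ.2 g, hP]

/-- **The `ε`-part of `P⁻¹ ρ(g) P`** for `P ∈ GL₂(K[ε])` with `fst P = P̄`, `T = snd P`: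
`snd(P⁻¹ρ(g)P) = P̄⁻¹ (ρ̄(g) T P̄⁻¹ + c(g) ρ̄(g) − T P̄⁻¹ ρ̄(g)) P̄`. [folklore] -/
theorem map_snd_conj' (ρ : DualLift ρbar) (P : GL (Fin 2) (TrivSqZeroExt K K)) (g : Γ)
    (Pbar : GL (Fin 2) K) (hP : P.val.map fst = Pbar.val) :
    (P⁻¹ * ρ.1 g * P).val.map snd =
      Pbar⁻¹.val * ((ρbar g).val * P.val.map snd * Pbar⁻¹.val + (ρ.cocycle).1 g * (ρbar g).val -
        P.val.map snd * Pbar⁻¹.val * (ρbar g).val) * Pbar.val := by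
  rw [Units.val_mul, Units.val_mul, matrix_map_snd_mul, matrix_map_fst_mul, matrix_map_snd_mul,
    hP, ρ.2 g, map_fst_inv P Pbar hP, map_snd_inv P Pbar hP]
  change _ + (_ * ρ.sndPart g + _) * _ = _
  rw [sndPart_eq_cocycle_mul]
  simp only [Matrix.neg_mul, Matrix.mul_add, Matrix.add_mul, Matrix.mul_sub, Matrix.sub_mul,
    Matrix.mul_assoc, Units.inv_mul, Matrix.mul_one]
  abel

/-- An entry of a matrix over `K[ε]` vanishes iff its `fst`- and `snd`-parts do. [folklore] -/
theorem apply_eq_zero_iff (M : Matrix (Fin 2) (Fin 2) (TrivSqZeroExt K K)) (i j : Fin 2) :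
    M i j = 0 ↔ M.map fst i j = 0 ∧ M.map snd i j = 0 := by
  rw [Matrix.map_apply, Matrix.map_apply]
  constructor
  · intro h
    rw [h]
    exact ⟨fst_zero, snd_zero⟩
  · rintro ⟨h1, h2⟩
    exact TrivSqZeroExt.ext h1 h2

/-- **The nearly ordinary condition at `K[ε]` in terms of cocycles** (tangent space of the
`P`-nearly ordinary functor, Böckle Ex. 7.1 / Lemma 7.4; Mazur §23): let `f ∈ GL₂(K)` be a frame
in which `ρ̄ ∘ ι` is upper triangular.  Then `ρ = (1 + εc)ρ̄` admits `P ∈ GL₂(K[ε])` whose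
reduction has special line `f e₁` (`f⁻¹ P̄` upper triangular) and with `P⁻¹ ρ(ι δ) P` upper
triangular for all `δ`, iff for some `Y ∈ M₂(K)` every
`f⁻¹ c(ι δ) f + ρ̄_f(δ) Y ρ̄_f(δ)⁻¹ − Y` (`ρ̄_f = f⁻¹ ρ̄ f`) is upper triangular — i.e. `c|_Δ`, in
the frame `f`, is cohomologous to a cocycle with values in the upper-triangular Borel `𝔟`.
[cite: Bockle2007Presentations, Lemma 7.4] [cite: Mazur1997Deformation, §23] -/
theorem exists_noFrame_iff (ρ : DualLift ρbar) {Δ : Type*} (ι : Δ → Γ) (f : GL (Fin 2) K)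
    (hf : ∀ δ, (f⁻¹ * ρbar (ι δ) * f).val 1 0 = 0) :
    (∃ P : GL (Fin 2) (TrivSqZeroExt K K), (f⁻¹.val * P.val.map fst) 1 0 = 0 ∧
        ∀ δ, (P⁻¹ * ρ.1 (ι δ) * P).val 1 0 = 0) ↔
      ∃ Y : Matrix (Fin 2) (Fin 2) K, ∀ δ,
        (f⁻¹.val * (ρ.cocycle).1 (ι δ) * f.val +
          (f⁻¹ * ρbar (ι δ) * f).val * Y * (f⁻¹ * ρbar (ι δ) * f)⁻¹.val - Y) 1 0 = 0 := by
  -- the key identity: for `P̄ = f b`, `T = snd P`, `Y = f⁻¹ T b⁻¹`: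
  -- `f⁻¹ (ρ̄ T P̄⁻¹ + c ρ̄ − T P̄⁻¹ ρ̄) f = (ρ̄_f Y ρ̄_f⁻¹ + c_f − Y) ρ̄_f`
  have key : ∀ (b : GL (Fin 2) K) (T : Matrix (Fin 2) (Fin 2) K) (δ : Δ),
      f⁻¹.val * ((ρbar (ι δ)).val * T * (f * b)⁻¹.val + (ρ.cocycle).1 (ι δ) * (ρbar (ι δ)).val -
          T * (f * b)⁻¹.val * (ρbar (ι δ)).val) * f.val =
        (f⁻¹.val * (ρ.cocycle).1 (ι δ) * f.val +
          (f⁻¹ * ρbar (ι δ) * f).val * (f⁻¹.val * T * b⁻¹.val) * (f⁻¹ * ρbar (ι δ) * f)⁻¹.val -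
            f⁻¹.val * T * b⁻¹.val) * (f⁻¹ * ρbar (ι δ) * f).val := by
    intro b T δ
    simp only [_root_.mul_inv_rev, inv_inv, Units.val_mul, Matrix.mul_add, Matrix.add_mul,
      Matrix.mul_sub, Matrix.sub_mul, Matrix.mul_assoc, Units.inv_mul_cancel_left,
      Units.mul_inv_cancel_left, Units.inv_mul, Matrix.mul_one]
    abel
  constructor
  · rintro ⟨P, h1, h2⟩
    set Pbar : GL (Fin 2) K :=
      Matrix.GeneralLinearGroup.map (TrivSqZeroExt.fstHom K K K : TrivSqZeroExt K K →+* K) P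
      with hPbar
    have hP : P.val.map fst = Pbar.val := rfl
    set b : GL (Fin 2) K := f⁻¹ * Pbar with hb
    have hb10 : b.val 1 0 = 0 := by rw [hb, Units.val_mul]; exact h1
    have hPb : Pbar = f * b := by rw [hb, mul_inv_cancel_left]
    refine ⟨f⁻¹.val * P.val.map snd * b⁻¹.val, fun δ => ?_⟩
    -- from `h2`: the `snd`-part of the `(1,0)` entry of `P⁻¹ ρ P` vanishes
    have h3 := ((apply_eq_zero_iff _ 1 0).mp (h2 δ)).2
    rw [map_snd_conj' ρ P (ι δ) Pbar hP] at h3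
    -- `P̄⁻¹ N P̄ = b⁻¹ (f⁻¹ N f) b`
    have hconj : ∀ N : Matrix (Fin 2) (Fin 2) K,
        Pbar⁻¹.val * N * Pbar.val = b⁻¹.val * (f⁻¹.val * N * f.val) * b.val := by
      intro N
      rw [hPb, _root_.mul_inv_rev, Units.val_mul, Units.val_mul]
      simp only [Matrix.mul_assoc]
    rw [hconj] at h3
    have h4 := (lowerLeft_conj_eq_zero_iff_of_upper hb10 _).mp h3
    rw [← mul_lowerLeft_eq_zero_iff_of_upper (hf δ), ← key b (P.val.map snd) δ, ← hPb]
    exact h4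
  · rintro ⟨Y, hY⟩
    refine ⟨dualUnit f (f.val * Y), ?_, fun δ => ?_⟩
    · rw [dualUnit_val_map_fst, ← Units.val_mul, inv_mul_cancel, Units.val_one,
        Matrix.one_apply_ne (by decide)]
    · have hP : (dualUnit f (f.val * Y)).val.map fst = f.val := dualUnit_val_map_fst _ _
      refine (apply_eq_zero_iff _ 1 0).mpr ⟨?_, ?_⟩
      · rw [map_fst_conj ρ _ (ι δ) f hP, ← Units.val_mul, ← Units.val_mul]
        exact hf δ
      · rw [map_snd_conj' ρ _ (ι δ) f hP, dualUnit_val_map_snd]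
        have h1 := key 1 (f.val * Y) δ
        rw [mul_one, inv_one, Units.val_one, Matrix.mul_one, ← Matrix.mul_assoc f⁻¹.val f.val Y,
          ← Units.val_mul, inv_mul_cancel, Units.val_one, Matrix.one_mul] at h1
        rw [h1, mul_lowerLeft_eq_zero_iff_of_upper (hf δ)]
        exact hY δ

end NearlyOrdinary

end DualLift

end Literature.NumberTheory.GaloisRepresentations.Deformation
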